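import Summits.BirchSwinnertonDyer.Rank1Residual.Additive.XGssRankZeroCyclotomicThreeSharp
import Summits.BirchSwinnertonDyer.Rank1Residual.Additive.X3RankZeroCyclotomicThreeFacts
import Summits.BirchSwinnertonDyer.Rank1Residual.Additive.TwistRamTransport
import Summits.BirchSwinnertonDyer.Rank1Residual.X11b.AnticyclotomicTowerTorsion
import Summits.BirchSwinnertonDyer.Rank1Residual.Partition.CellOf
import Literature.NumberTheory.EllipticCurves.Kobayashi2003.PlusDivisibilityCyclotomicThree
import Literature.NumberTheory.EllipticCurves.KitajimaOtsuki2018.PlusSelmerNoFiniteSubmodule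
import Literature.NumberTheory.EllipticCurves.Rank1Residual.Typed.CasselsLowerBound
import HarnessLib

/-!
# X4 ∧ (G, e = 2) ∧ `p = 3` ∧ `V = W^{(−3)}` good SUPERSINGULAR with `a₃(V) = 0` ∧ ranks `(0,0)`:
# `BSD₃(W) ∧ BSD₃(V)` on the ℚ-SIDE unit rows, from named facts only (line V18♯)

HONEST FRAMING (cell `b2b-bsdres`, run/shared/lean/b2b/bsd-rank1-residual/, verbatim in every
file): the goal of the cell is to DELETE the COMBINATION-SHAPED residual classes of the
Birch–Swinnerton-Dyer formula for ALL analytic-rank `≤ 1` elliptic curves over `ℚ` — "full BSD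
formula for every rank `≤ 1` curve in class `C`" assembled STRICTLY from published theorems — so
that the rank-`≤ 1` remainder becomes exactly the CONSTRUCTION-SHAPED classes, which are TYPED
(missing-input `Prop`s), NOT attempted. This is not "finishing BSD". Seat additive-p4 (research route
on X3/X4); the label of X4 is UNCHANGED by this file; nothing is booked here (referee's call).

Theorems only (no `def`, no `sorry`, no new named fact). The facts-only corollaries of the SHARP core
`XGssRankZeroCyclotomicThree.exists_padicVal_shaOrder_add_le_sharp`
(`XGssRankZeroCyclotomicThreeSharp.lean`: Milne's identity replaced by the quadratic Selmer comparison
isomorphism, so that NO datum over `K = ℚ(ζ₃)` remains): inputs are the NAMED FACTS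
`Kobayashi2003.thm41_plusCharIdeal_dvd_cyclotomicThree` (Thm. 4.1 (+, both `η`) / 2.2 / 3.2 over
`ℚ(ζ₃)`), `KitajimaOtsuki2018.mainThm13_plusSelmerDual_noFiniteSubmodule`,
`pollack_exists_plusMinusPAdicLFunction`, modularity (`hmod`, `hmodD`), GZK (`hGZK`) — Milne 1972 is NOT
used — and the census bits `surj(3)`, `ram(3)` of the additive curve `W`.

* `XGssCyclotomicThreeSharp.exists_padicVal_shaOrder_add_le_of_facts[_of_surj_of_ram]`:
  **`ord₃#Ш(V) + ord₃#Ш(W) + 2(ord₃#V(ℚ) + ord₃#W(ℚ)) ≤ ord₃#Ш_an(V) + ord₃#Ш_an(W) + ord₃∏c(V) + ord₃∏c(W)`**;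
* `….missingUpperBoundAt_of_surj_of_ram`: `3 ∤ #Ш_an(V)·∏c(V)·∏c(W)` ⇒ `Typed.MissingUpperBoundAt W 3`;
* `….bsdp_of_units_of_surj_of_ram`: `3 ∤ #Ш_an(V)·#Ш_an(W)·∏c(V)·∏c(W)` ⇒ **`BSD(W,3) ∧ BSD(V,3)`**;
* class level: `ClassX4.exists_padicVal_shaOrder_add_le_three_of_ssTwist_sharp`,
  `ClassX4.bsdp_three_of_ssTwist_of_units`.

Census (`HOME/b2b-bsdres-additive-p4/V18-CENSUS.tsv`, hyp cyc3 two-engine, `N < 2·10⁴`): 18 CORE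
rows (all doubly-unit, `surj(3)`); `3 ∤ ∏c(V)·∏c(W)` on 12 of them, 11 with a (ram) prime ⇒
`BSD₃(W) ∧ BSD₃(V)` on 11 rows from ℚ-side census bits alone (no `K`-Tamagawa datum, no Milne).
-/

noncomputable section

open scoped Classical MatrixGroups ModularForm

open CongruenceSubgroup WeierstrassCurve NumberField
  Literature.NumberTheory.EllipticCurves Literature.NumberTheory.EllipticCurves.ModularForms
  Literature.NumberTheory.EllipticCurves.Rank1Residual
  Literature.NumberTheory.EllipticCurves.Rank1Residual.Typed
  Literature.NumberTheory.EllipticCurves.Kobayashi2003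
  Literature.NumberTheory.GaloisRepresentations

namespace Summit.BirchSwinnertonDyer.Rank1Residual.Additive

section Facts

variable (V : WeierstrassCurve ℚ) [V.IsElliptic] [V.IsGloballyMinimal]
  (W : WeierstrassCurve ℚ) [W.IsElliptic] [W.IsGloballyMinimal]

/-- **Line V18, core inequality, from named facts only** (`K = ℚ(ζ₃)` instantiated as
`CyclotomicField 3 ℚ`): for `V/ℚ` globally minimal, good at `3` with `a₃(V) = 0`, `ρ̄_{V,3ⁿ}` onto
for every `n` and a (ram) prime for `V`, `W = C • V^{(−3)}` globally minimal ADDITIVE at `3`, both of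
analytic rank `0`: `#Ш_an(V) = q_V`, `#Ш_an(W) = q_W` with
**`ord₃ #Ш(V) + ord₃ #Ш(W) + 2(ord₃ #V(ℚ) + ord₃ #W(ℚ)) ≤ ord₃ q_V + ord₃ q_W + ord₃ ∏c(V) + ord₃ ∏c(W)`**, from
Kobayashi Thm. 4.1/2.2/3.2 (`hKob`, named fact), Kitajima–Otsuki Main Thm. 1.3 (`hKO`, named fact),
Pollack's existence of `L₃⁺(V,X)` (`hPol`, named fact), the PROVED quadratic Selmer comparison
(Dokchitser–Dokchitser), modularity (`hmod`, `hmodD`), GZK (`hGZK`); the cyclotomic setting and `V(K_∞)[3^∞] = 0` (from `Irr ∧ Ram`) are theorems.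
[cite: Kobayashi2003, Thm. 4.1 (p. 8)] [cite: KitajimaOtsuki2018, Main Thm. 1.3]
[cite: DokchitserDokchitserAnnals2010, Lemma 4.14 (proof)] -/
theorem XGssCyclotomicThreeSharp.exists_padicVal_shaOrder_add_le_of_facts
    (hKob : Kobayashi2003.thm41_plusCharIdeal_dvd_cyclotomicThree)
    (hKO : KitajimaOtsuki2018.mainThm13_plusSelmerDual_noFiniteSubmodule)
    (hPol : ∀ {N : ℕ} [NeZero N] (f : CuspForm (Gamma0 N) 2),
      pollack_exists_plusMinusPAdicLFunction (W := V) (f := f) (p := 3))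
    (hGZK : rank_eq_analyticRank_of_analyticRank_le_one) (hmod : hasEntireLFunction_rat)
    (hmodD : nonempty_modularParametrizationData)
    (C : VariableChange ℚ) (hC : C • V.quadraticTwist (-(3 : ℚ)) = W)
    (hgood : V.HasGoodReductionAtPrime 3) (ha3 : V.frobeniusTrace 3 = 0)
    (hsurj : ∀ n : ℕ, V.HasSurjectiveModNGaloisRep (3 ^ n : ℕ)) (hirr : Irr V 3) (hram : Ram V 3)
    (hadd : Addv W 3) (hrV : V.analyticRank = 0) (hrW : W.analyticRank = 0) :
    ∃ qV qW : ℚ, shaAn V = (qV : ℂ) ∧ shaAn W = (qW : ℂ) ∧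
      (padicValNat 3 V.shaOrder : ℤ) + padicValNat 3 W.shaOrder +
          2 * (padicValNat 3 (Nat.card V.toAffine.Point) + padicValNat 3 (Nat.card W.toAffine.Point)) ≤
        padicValRat 3 qV + padicValRat 3 qW +
          padicValNat 3 V.tamagawaProduct + padicValNat 3 W.tamagawaProduct := by
  haveI : IsCyclotomicExtension {3} ℚ (CyclotomicField 3 ℚ) := CyclotomicField.isCyclotomicExtension 3 ℚ
  have h2 : Module.finrank ℚ (CyclotomicField 3 ℚ) = 2 :=
    finrank_eq_two_of_isCyclotomicExtension_three (K := CyclotomicField 3 ℚ)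
  -- the newform, the two rational period ratios, Pollack's `L₃⁺(V, X)`
  haveI : NeZero (V.conductorNorm ℤ) := ⟨(V.conductorNorm_pos_holds).ne'⟩
  obtain ⟨Dm⟩ := hmodD V
  have hf : IsNewformOf V Dm.f := Dm.isNewformOf
  obtain ⟨ϖ, -, hϖ, -⟩ := Dm.exists_rat_mul_realPeriodRat_eq_plusPeriod
  obtain ⟨ϖ', -, hϖ'⟩ := exists_rat_mul_imaginaryPeriodRat_eq_minusPeriod Dm
  obtain ⟨L, -, hL⟩ := exists_isSignedPAdicLFunction (hPol Dm.f) (by norm_num) hf hgood ha3 1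
  haveI : (V.baseChange (CyclotomicField 3 ℚ)).IsElliptic := by rw [baseChange]; infer_instance
  refine XGssRankZeroCyclotomicThree.exists_padicVal_shaOrder_add_le_sharp (CyclotomicField 3 ℚ) V W
    hGZK hmod C hC hgood ha3 hadd hrV hrW hf ϖ ϖ' hϖ hϖ' L hL
    (exists_isCyclotomic_isTopGenerator_cyclotomicThree (CyclotomicField 3 ℚ))
    (fun κ ↦ X11b.fixedPoints_kerSubgroup_eq_bot_of_irr_of_ram V 3 (by norm_num) hirr hram
      (CyclotomicField 3 ℚ) h2 κ)
    (fun κ γ hκ hγ hγ' D ↦ ?_) (fun κ γ hκ hγ D _ hX N' hN' ↦ ?_)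
  · obtain ⟨hfin, hX, Lω, hLω, -, hsurj'⟩ := hKob V (CyclotomicField 3 ℚ)
      (V.baseChange (CyclotomicField 3 ℚ)) hgood ha3 ⟨1, one_smul _ _⟩ hκ hγ hγ' hf L hL D ϖ ϖ' hϖ hϖ'
    exact ⟨hfin, hX, Lω, hLω, hsurj' hsurj⟩
  · exact hKO V 3 (by norm_num) hgood ha3 (CyclotomicField 3 ℚ) (V.baseChange (CyclotomicField 3 ℚ))
      ⟨1, one_smul _ _⟩ κ γ hκ hγ D hX N' hN'

/-- **Line V18 with the image hypotheses as CENSUS BITS of `W`**: `surj(3)` and `ram(3)` of the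
additive curve `W` give, for the twist `V = W^{(−3)}`, `ρ̄_{V,3ⁿ}` onto for all `n`
(`forall_surj_pow_of_twist_pStar_of_surj_of_ram`), `Irr V 3` (`surj_iff_of_model_twist`,
`irr_of_surj`) and `Ram V 3` (`ram_of_twist_pStar`); hence the core inequality on X4 ∧ (G, `e = 2`) ∧
`p = 3` ∧ `V` good supersingular, `a₃(V) = 0` ∧ ranks `(0,0)` ∧ `surj(3) ∧ ram(3)`, from named facts.
[cite: Kobayashi2003, Thm. 4.1 (p. 8)] [cite: KitajimaOtsuki2018, Main Thm. 1.3] -/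
theorem XGssCyclotomicThreeSharp.exists_padicVal_shaOrder_add_le_of_facts_of_surj_of_ram
    (hKob : Kobayashi2003.thm41_plusCharIdeal_dvd_cyclotomicThree)
    (hKO : KitajimaOtsuki2018.mainThm13_plusSelmerDual_noFiniteSubmodule)
    (hPol : ∀ {N : ℕ} [NeZero N] (f : CuspForm (Gamma0 N) 2),
      pollack_exists_plusMinusPAdicLFunction (W := V) (f := f) (p := 3))
    (hGZK : rank_eq_analyticRank_of_analyticRank_le_one) (hmod : hasEntireLFunction_rat)
    (hmodD : nonempty_modularParametrizationData)
    (C : VariableChange ℚ) (hC : C • V.quadraticTwist (-(3 : ℚ)) = W)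
    (hgood : V.HasGoodReductionAtPrime 3) (ha3 : V.frobeniusTrace 3 = 0)
    (hsurj : Surj W 3) (hram : Ram W 3)
    (hadd : Addv W 3) (hrV : V.analyticRank = 0) (hrW : W.analyticRank = 0) :
    ∃ qV qW : ℚ, shaAn V = (qV : ℂ) ∧ shaAn W = (qW : ℂ) ∧
      (padicValNat 3 V.shaOrder : ℤ) + padicValNat 3 W.shaOrder +
          2 * (padicValNat 3 (Nat.card V.toAffine.Point) + padicValNat 3 (Nat.card W.toAffine.Point)) ≤
        padicValRat 3 qV + padicValRat 3 qW +
          padicValNat 3 V.tamagawaProduct + padicValNat 3 W.tamagawaProduct := by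
  have hC' : C • V.quadraticTwist (((-((3 : ℕ) : ℤ)) : ℤ) : ℚ) = W := by push_cast; exact hC
  have hsurjV : Surj V 3 :=
    (surj_iff_of_model_twist V 3 (d := -(3 : ℚ)) (by norm_num) ⟨C, hC⟩).mp hsurj
  exact XGssCyclotomicThreeSharp.exists_padicVal_shaOrder_add_le_of_facts V W hKob hKO hPol hGZK
    hmod hmodD C hC hgood ha3
    (forall_surj_pow_of_twist_pStar_of_surj_of_ram 3 V (k := -1) (by norm_num) (Or.inr rfl) C hC'
      hsurj hram)
    (irr_of_surj V 3 hsurjV) (ram_of_twist_pStar 3 V (k := -1) (by norm_num) (Or.inr rfl) C hC' hram)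
    hadd hrV hrW

/-- **The cell's typed UPPER half for the additive X4 curve, from named facts only**: in the
situation of `XGssCyclotomicThreeSharp.exists_padicVal_shaOrder_add_le_of_facts_of_surj_of_ram`, if
`3 ∤ #Ш_an(V)` (a bit of the TWIST pair) and `3 ∤ ∏c(V)·∏c(W)` (ℚ-side Tamagawa bits) then `ord₃ #Ш(W) ≤ ord₃ #Ш_an(W)`, i.e.
`Typed.MissingUpperBoundAt W 3`. [cite: Kobayashi2003, Thm. 4.1 (p. 8)] [cite: KitajimaOtsuki2018, Main Thm. 1.3] -/
theorem XGssCyclotomicThreeSharp.missingUpperBoundAt_of_surj_of_ram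
    (hKob : Kobayashi2003.thm41_plusCharIdeal_dvd_cyclotomicThree)
    (hKO : KitajimaOtsuki2018.mainThm13_plusSelmerDual_noFiniteSubmodule)
    (hPol : ∀ {N : ℕ} [NeZero N] (f : CuspForm (Gamma0 N) 2),
      pollack_exists_plusMinusPAdicLFunction (W := V) (f := f) (p := 3))
    (hGZK : rank_eq_analyticRank_of_analyticRank_le_one) (hmod : hasEntireLFunction_rat)
    (hmodD : nonempty_modularParametrizationData)
    (C : VariableChange ℚ) (hC : C • V.quadraticTwist (-(3 : ℚ)) = W)
    (hgood : V.HasGoodReductionAtPrime 3) (ha3 : V.frobeniusTrace 3 = 0)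
    (hsurj : Surj W 3) (hram : Ram W 3)
    (hadd : Addv W 3) (hrV : V.analyticRank = 0) (hrW : W.analyticRank = 0)
    {qV : ℚ} (hqV : shaAn V = (qV : ℂ)) (hv : padicValRat 3 qV ≤ 0)
    (htamV : padicValNat 3 V.tamagawaProduct = 0) (htamW : padicValNat 3 W.tamagawaProduct = 0) :
    MissingUpperBoundAt W 3 := by
  obtain ⟨qV', qW, hqV', hqW, hle⟩ :=
    XGssCyclotomicThreeSharp.exists_padicVal_shaOrder_add_le_of_facts_of_surj_of_ram V W hKob hKO hPol
      hGZK hmod hmodD C hC hgood ha3 hsurj hram hadd hrV hrW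
  have hqq : qV' = qV := by exact_mod_cast hqV'.symm.trans hqV
  subst hqq
  refine ⟨qW, hqW, ?_⟩
  have h0 : (0 : ℤ) ≤ padicValNat 3 V.shaOrder := by positivity
  have h1 : (0 : ℤ) ≤ padicValNat 3 (Nat.card V.toAffine.Point) := by positivity
  have h1' : (0 : ℤ) ≤ padicValNat 3 (Nat.card W.toAffine.Point) := by positivity
  rw [htamV, htamW, Nat.cast_zero, add_zero, add_zero] at hle
  linarith

/-- **`BSD(W,3) ∧ BSD(V,3)` on the unit X4 rows of line V18, from named facts only**: in the
situation of `XGssCyclotomicThreeSharp.exists_padicVal_shaOrder_add_le_of_facts_of_surj_of_ram`, if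
`#Ш_an(V)`, `#Ш_an(W)`, `∏c(V)`, `∏c(W)` are `3`-adic units, then Miller's
`BSD(W,3)` (the ADDITIVE, potentially supersingular X4 pair: `W` of type `I₀*` at `3`, `W[3]`
irreducible) and `BSD(V,3)` (its good supersingular big-image twist, `a₃(V) = 0`) hold. Inputs:
Kobayashi 2003 Thm. 4.1/2.2/3.2, Kitajima–Otsuki 2018 Main Thm. 1.3, Pollack 2003, Milne (named
facts), modularity, GZK, and the census bits `surj(3)`, `ram(3)`, `3 ∤ #Ш_an` and `3 ∤ ∏c` of the two curves — nothing typed; Milne NOT used. Label X4 UNCHANGED; nothing booked by this theorem.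
[cite: Kobayashi2003, Thm. 4.1 (p. 8)] [cite: KitajimaOtsuki2018, Main Thm. 1.3]
[cite: DokchitserDokchitserAnnals2010, Lemma 4.14 (proof)] -/
theorem XGssCyclotomicThreeSharp.bsdp_of_units_of_surj_of_ram
    (hKob : Kobayashi2003.thm41_plusCharIdeal_dvd_cyclotomicThree)
    (hKO : KitajimaOtsuki2018.mainThm13_plusSelmerDual_noFiniteSubmodule)
    (hPol : ∀ {N : ℕ} [NeZero N] (f : CuspForm (Gamma0 N) 2),
      pollack_exists_plusMinusPAdicLFunction (W := V) (f := f) (p := 3))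
    (hGZK : rank_eq_analyticRank_of_analyticRank_le_one) (hmod : hasEntireLFunction_rat)
    (hmodD : nonempty_modularParametrizationData)
    (C : VariableChange ℚ) (hC : C • V.quadraticTwist (-(3 : ℚ)) = W)
    (hgood : V.HasGoodReductionAtPrime 3) (ha3 : V.frobeniusTrace 3 = 0)
    (hsurj : Surj W 3) (hram : Ram W 3)
    (hadd : Addv W 3) (hrV : V.analyticRank = 0) (hrW : W.analyticRank = 0)
    {qV qW : ℚ} (hqV : shaAn V = (qV : ℂ)) (hqW : shaAn W = (qW : ℂ))
    (hvV : padicValRat 3 qV = 0) (hvW : padicValRat 3 qW = 0)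
    (htamV : padicValNat 3 V.tamagawaProduct = 0) (htamW : padicValNat 3 W.tamagawaProduct = 0) :
    BSDp W 3 ∧ BSDp V 3 := by
  obtain ⟨qV', qW', hqV', hqW', hle⟩ :=
    XGssCyclotomicThreeSharp.exists_padicVal_shaOrder_add_le_of_facts_of_surj_of_ram V W hKob hKO hPol
      hGZK hmod hmodD C hC hgood ha3 hsurj hram hadd hrV hrW
  have hqq : qV' = qV := by exact_mod_cast hqV'.symm.trans hqV
  have hqq' : qW' = qW := by exact_mod_cast hqW'.symm.trans hqW
  subst hqq hqq'
  rw [hvV, hvW, htamV, htamW, Nat.cast_zero, add_zero, add_zero, add_zero] at hle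
  have hV0 : (0 : ℤ) ≤ padicValNat 3 V.shaOrder := by positivity
  have hW0 : (0 : ℤ) ≤ padicValNat 3 W.shaOrder := by positivity
  have hK0 : (0 : ℤ) ≤ padicValNat 3 (Nat.card V.toAffine.Point) := by positivity
  have hK0' : (0 : ℤ) ≤ padicValNat 3 (Nat.card W.toAffine.Point) := by positivity
  have huW : MissingUpperBoundAt W 3 := ⟨qW', hqW', by rw [hvW]; linarith⟩
  have huV : MissingUpperBoundAt V 3 := ⟨qV', hqV', by rw [hvV]; linarith⟩
  exact ⟨bsdp_of_missingPPartAt W 3 hGZK (by rw [hrW]; exact zero_le_one)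
      (missingPPartAt_of_upper_of_shaAn_unit W 3 huW hqW' hvW),
    bsdp_of_missingPPartAt V 3 hGZK (by rw [hrV]; exact zero_le_one)
      (missingPPartAt_of_upper_of_shaAn_unit V 3 huV hqV' hvV)⟩

/-- **X4 at `p = 3`, class level, ranks `(0,0)`, SUPERSINGULAR twist, ℚ-side form: the sum
inequality.** For an X4 pair `(W, 3)` (`ClassX4 W 3`) with `surj(3)`, `ram(3)` and a globally minimal
`V`, `C • V^{(−3)} = W`, good at `3` with `a₃(V) = 0`, ranks `(0,0)`:
**`ord₃#Ш(V) + ord₃#Ш(W) + 2(ord₃#V(ℚ) + ord₃#W(ℚ)) ≤ ord₃#Ш_an(V) + ord₃#Ш_an(W) + ord₃∏c(V) + ord₃∏c(W)`**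
from the named facts of line V18 (no Milne, no `K`-side datum).
[cite: Kobayashi2003, Thm. 4.1 (p. 8)] [cite: KitajimaOtsuki2018, Main Thm. 1.3]
[cite: DokchitserDokchitserAnnals2010, Lemma 4.14 (proof)] -/
theorem ClassX4.exists_padicVal_shaOrder_add_le_three_of_ssTwist_sharp
    (hKob : Kobayashi2003.thm41_plusCharIdeal_dvd_cyclotomicThree)
    (hKO : KitajimaOtsuki2018.mainThm13_plusSelmerDual_noFiniteSubmodule)
    (hPol : ∀ {N : ℕ} [NeZero N] (f : CuspForm (Gamma0 N) 2),
      pollack_exists_plusMinusPAdicLFunction (W := V) (f := f) (p := 3))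
    (hGZK : rank_eq_analyticRank_of_analyticRank_le_one) (hmod : hasEntireLFunction_rat)
    (hmodD : nonempty_modularParametrizationData)
    (hX : ClassX4 W 3) (hsurj : Surj W 3) (hram : Ram W 3)
    (C : VariableChange ℚ) (hC : C • V.quadraticTwist (-(3 : ℚ)) = W)
    (hgood : V.HasGoodReductionAtPrime 3) (ha3 : V.frobeniusTrace 3 = 0)
    (hrV : V.analyticRank = 0) (hrW : W.analyticRank = 0) :
    ∃ qV qW : ℚ, shaAn V = (qV : ℂ) ∧ shaAn W = (qW : ℂ) ∧
      (padicValNat 3 V.shaOrder : ℤ) + padicValNat 3 W.shaOrder +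
          2 * (padicValNat 3 (Nat.card V.toAffine.Point) + padicValNat 3 (Nat.card W.toAffine.Point)) ≤
        padicValRat 3 qV + padicValRat 3 qW +
          padicValNat 3 V.tamagawaProduct + padicValNat 3 W.tamagawaProduct :=
  XGssCyclotomicThreeSharp.exists_padicVal_shaOrder_add_le_of_facts_of_surj_of_ram V W hKob hKO hPol
    hGZK hmod hmodD C hC hgood ha3 hsurj hram hX.2.1 hrV hrW

/-- **X4 at `p = 3`, class level, supersingular twist: `BSD(W,3) ∧ BSD(V,3)` on the ℚ-side unit
rows** (`#Ш_an(V)`, `#Ш_an(W)`, `∏c(V)`, `∏c(W)` all `3`-adic units; `surj(3) ∧ ram(3)`): Miller's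
`BSD(W,3)` for the ADDITIVE potentially supersingular X4 pair and `BSD(V,3)` for its twist, from
Kobayashi 2003, Kitajima–Otsuki 2018, Pollack 2003, modularity, GZK and census bits ONLY. Census:
11 of the 18 CORE rows. Labels UNCHANGED; nothing booked by this theorem.
[cite: Kobayashi2003, Thm. 4.1 (p. 8)] [cite: KitajimaOtsuki2018, Main Thm. 1.3]
[cite: Miller2011LMS, §1 and Def. 1.1] -/
theorem ClassX4.bsdp_three_of_ssTwist_of_units
    (hKob : Kobayashi2003.thm41_plusCharIdeal_dvd_cyclotomicThree)
    (hKO : KitajimaOtsuki2018.mainThm13_plusSelmerDual_noFiniteSubmodule)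
    (hPol : ∀ {N : ℕ} [NeZero N] (f : CuspForm (Gamma0 N) 2),
      pollack_exists_plusMinusPAdicLFunction (W := V) (f := f) (p := 3))
    (hGZK : rank_eq_analyticRank_of_analyticRank_le_one) (hmod : hasEntireLFunction_rat)
    (hmodD : nonempty_modularParametrizationData)
    (hX : ClassX4 W 3) (hsurj : Surj W 3) (hram : Ram W 3)
    (C : VariableChange ℚ) (hC : C • V.quadraticTwist (-(3 : ℚ)) = W)
    (hgood : V.HasGoodReductionAtPrime 3) (ha3 : V.frobeniusTrace 3 = 0)
    (hrV : V.analyticRank = 0) (hrW : W.analyticRank = 0)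
    {qV qW : ℚ} (hqV : shaAn V = (qV : ℂ)) (hqW : shaAn W = (qW : ℂ))
    (hvV : padicValRat 3 qV = 0) (hvW : padicValRat 3 qW = 0)
    (htamV : padicValNat 3 V.tamagawaProduct = 0) (htamW : padicValNat 3 W.tamagawaProduct = 0) :
    BSDp W 3 ∧ BSDp V 3 :=
  XGssCyclotomicThreeSharp.bsdp_of_units_of_surj_of_ram V W hKob hKO hPol hGZK hmod hmodD C hC hgood
    ha3 hsurj hram hX.2.1 hrV hrW hqV hqW hvV hvW htamV htamW

end Facts

end Summit.BirchSwinnertonDyer.Rank1Residual.Additive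

end
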